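import Literature.Barriers.AtomisticToContinuum.DisorderedHarmonicChainFurstenberg
import Literature.Barriers.AtomisticToContinuum.DisorderedHarmonicChainHighFrequency
import HarnessLib

/-!
# O'Connor's amplitude bound (39) from the Anderson-model facts

Bridge between the two routes to the high-frequency bound (H) of the Ajanki–Huveneers
decomposition in this cluster: `DisorderedHarmonicChainHighFrequency.lean` formalises O'Connor's
proof of his Thm 6 (CMP **45** (1975)) down to the moderate-deviation input (39),
`OConnor1975_amplitudeBound` (`ℙ(t_n(ω)² ≤ e^{γn}) ≤ C e^{-α√n}` uniformly on compact bands,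
`t_n² = D_n(e₁)² + D_{n-1}(e₁)²`), while `DisorderedHarmonicChainFurstenberg.lean` proves (H) from
Fürstenberg positivity and the vectorwise uniform LDT for the one-dimensional Anderson model
(Bucaj et al., TAMS **372** (2019), Thm 2.3 and Prop. 3.6). Here the latter two facts are shown
to imply O'Connor's (39) as well (`OConnor1975_amplitudeBound_of_anderson`), by Markov's
inequality from the locally uniform exponential decay of `𝔼 ‖Q_n e₁‖^{-s}`
(`chain_negMoment_decay_local`) and a finite subcover of the band; the rate obtained is `e^{-αn}`.
The argument is also stated with the pointwise core `𝔼 log‖Q_N(ω)v‖ ≥ 2` as an explicit hypothesis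
(`OConnor1975_amplitudeBound_of_core`), so that it applies to any derivation of the core.
-/

noncomputable section

namespace Literature.Barriers.AtomisticToContinuum

open HeatConduction Literature.Probability.RandomMatrixProducts MeasureTheory

/-- **O'Connor's amplitude bound (39) from the pointwise core.** If for every admissible mass
density every frequency `ω > 0` has a scale `N` with `𝔼 log‖Q_N(ω) v‖ ≥ 2` for all unit `v`, then
`ℙ(t_n² ≤ e^{γn}) ≤ C e^{-αn}` uniformly on compact bands (Markov's inequality from the locally
uniform decay `𝔼 ‖Q_n e₁‖^{-s} ≤ C e^{-cn}` of `chain_negMoment_decay_local_of_core`, finite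
subcover). [cite: OConnor1975, §3 eq. (39)] -/
theorem OConnor1975_amplitudeBound_of_core
    (hcore : ∀ (τ : ℝ → ℝ) (a b : ℝ), MassDensityHyp τ a b →
      ∀ (ρ : Measure ℝ) [IsProbabilityMeasure ρ],
        ρ = volume.withDensity (fun s => ENNReal.ofReal (τ s)) →
        ∀ ω : ℝ, 0 < ω → ∃ N : ℕ, 1 ≤ N ∧ ∀ v : EuclideanSpace ℝ (Fin 2), ‖v‖ = 1 →
          2 ≤ ∫ m, Real.log ‖Matrix.toEuclideanLin (andersonTransferProd 2 (padSeq (ω ^ 2 • m)) N) v‖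
            ∂(Measure.pi fun _ : Fin N => ρ)) :
    OConnor1975_amplitudeBound := by
  intro τ a b hyp ρ _ hρ ω₀ ω₁ hω₀ hω₁
  set I : Set ℝ := Set.Icc ω₀ ω₁ with hI
  have H : ∀ ω ∈ I, ∃ δ s C c : ℝ, 0 < δ ∧ 0 < s ∧ s ≤ 1 ∧ 0 < C ∧ 0 < c ∧
      ∀ ω' ∈ I, |ω' - ω| < δ → ∀ n : ℕ,
        ∫⁻ m, ENNReal.ofReal (‖Matrix.toEuclideanLin (andersonTransferProd 2 (padSeq (ω' ^ 2 • m)) n)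
            (EuclideanSpace.single (0 : Fin 2) (1 : ℝ))‖ ^ (-s)) ∂(Measure.pi fun _ : Fin n => ρ) ≤
          ENNReal.ofReal (C * Real.exp (-(c * n))) := by
    intro ω hω
    obtain ⟨δ, hδ, s, hs0, hs1, C, c, hC, hc, h⟩ :=
      chain_negMoment_decay_local_of_core hyp hρ hω₀ hω (hcore τ a b hyp ρ hρ ω (hω₀.trans_le hω.1))
    exact ⟨δ, s, C, c, hδ, hs0, hs1, hC, hc, h⟩
  choose! δ s C c hδ hs0 hs1 hC hc hdec using H
  have hcover : I ⊆ ⋃ i : I, Metric.ball (i : ℝ) (δ i) := by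
    intro x hx
    exact Set.mem_iUnion.mpr ⟨⟨x, hx⟩, Metric.mem_ball_self (hδ x hx)⟩
  obtain ⟨t, ht⟩ := isCompact_Icc.elim_finite_subcover (fun i : I => Metric.ball (i : ℝ) (δ i))
    (fun _ => Metric.isOpen_ball) hcover
  have hω₀I : ω₀ ∈ I := ⟨le_rfl, hω₁⟩
  have htne : t.Nonempty := by
    have := ht hω₀I
    simp only [Set.mem_iUnion] at this
    obtain ⟨i, hi, -⟩ := this
    exact ⟨i, hi⟩
  -- constants
  set γ : ℝ := t.inf' htne fun i => c i / s i with hγ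
  set cmin : ℝ := t.inf' htne fun i => c i with hcmin
  set Csum : ℝ := ∑ i ∈ t, C i with hCsum
  have hγpos : 0 < γ := by
    rw [hγ, Finset.lt_inf'_iff]; exact fun i _ => div_pos (hc i i.2) (hs0 i i.2)
  have hcmin_pos : 0 < cmin := by
    rw [hcmin, Finset.lt_inf'_iff]; exact fun i _ => hc i i.2
  have hCsum_pos : 0 < Csum := Finset.sum_pos (fun i _ => hC i i.2) htne
  refine ⟨γ, hγpos, cmin / 2, by positivity, Csum, 0, fun k _ ω hω => ?_⟩
  -- the ball containing ω
  have hωcov := ht hω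
  simp only [Set.mem_iUnion] at hωcov
  obtain ⟨i, hit, hωi⟩ := hωcov
  rw [Metric.mem_ball, Real.dist_eq] at hωi
  have hiI : (i : ℝ) ∈ I := i.2
  set n : ℕ := k + 1 with hn
  set P : Measure (Fin (k + 1) → ℝ) := Measure.pi fun _ : Fin (k + 1) => ρ with hPdef
  set e₁ : EuclideanSpace ℝ (Fin 2) := EuclideanSpace.single (0 : Fin 2) (1 : ℝ) with he₁
  set g : (Fin (k + 1) → ℝ) → ℝ := fun m =>
    ‖Matrix.toEuclideanLin (andersonTransferProd 2 (padSeq (ω ^ 2 • m)) (k + 1)) e₁‖ ^ (-(s i)) with hg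
  have hgm : Measurable g := (measurable_norm_chainTransfer_apply ω (k + 1) e₁).pow_const _
  have hsi := hs0 i hiI
  have hci := hc i hiI
  have hCi := hC i hiI
  set ε : ℝ := Real.exp (-(s i * γ * n / 2)) with hε
  have hεpos : 0 < ε := Real.exp_pos _
  -- the event is contained in {ε ≤ g}
  set S : Set (Fin (k + 1) → ℝ) :=
    {m | chainD₁ m ω (k + 1) ^ 2 + chainD₁ m ω k ^ 2 ≤ Real.exp (γ * ((k + 1 : ℕ) : ℝ))} with hS
  have hsub : S ⊆ {m | ENNReal.ofReal ε ≤ ENNReal.ofReal (g m)} := by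
    intro m hm
    simp only [Set.mem_setOf_eq] at hm ⊢
    apply ENNReal.ofReal_le_ofReal
    set R := ‖Matrix.toEuclideanLin (andersonTransferProd 2 (padSeq (ω ^ 2 • m)) (k + 1)) e₁‖ with hR
    have hRpos : 0 < R := norm_transferProd_e₁_pos 2 _ (k + 1)
    have hR2 : R ^ 2 = chainD₁ m ω (k + 1) ^ 2 + chainD₁ m ω k ^ 2 := by
      rw [hR, he₁, norm_sq_toEuclideanLin_e₁, ← chainD₁_eq_transferProd m ω le_rfl,
        ← chainD₁_eq_transferProd_succ m ω le_rfl]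
    -- R² ≤ e^{γn} ⇒ R ≤ e^{γn/2} ⇒ R^{-s} ≥ e^{-sγn/2}
    have h1 : R ^ 2 ≤ Real.exp (γ * n) := by rw [hR2]; exact hm
    have h2 : R ≤ Real.exp (γ * n / 2) := by
      have : Real.exp (γ * n / 2) ^ 2 = Real.exp (γ * n) := by
        rw [← Real.exp_nat_mul]; congr 1; ring
      nlinarith [Real.exp_pos (γ * n / 2), this]
    show ε ≤ R ^ (-(s i))
    calc ε = (Real.exp (γ * n / 2)) ^ (-(s i)) := by
          rw [hε, ← Real.exp_mul]; congr 1; ring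
      _ ≤ R ^ (-(s i)) := Real.rpow_le_rpow_of_nonpos hRpos h2 (by linarith)
  -- Markov
  have hmarkov := mul_meas_ge_le_lintegral₀ (μ := P) hgm.ennreal_ofReal.aemeasurable (ENNReal.ofReal ε)
  have hlint := hdec i hiI ω hω hωi (k + 1)
  have hPS : P S ≤ ENNReal.ofReal (C i * Real.exp (-(c i * (k + 1 : ℕ))) / ε) := by
    have hε0 : ENNReal.ofReal ε ≠ 0 := by simpa using hεpos
    have hεtop : ENNReal.ofReal ε ≠ ⊤ := ENNReal.ofReal_ne_top
    calc P S ≤ P {m | ENNReal.ofReal ε ≤ ENNReal.ofReal (g m)} := measure_mono hsub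
      _ ≤ (∫⁻ m, ENNReal.ofReal (g m) ∂P) / ENNReal.ofReal ε := by
          rw [ENNReal.le_div_iff_mul_le (Or.inl hε0) (Or.inl hεtop), mul_comm]
          exact hmarkov
      _ ≤ ENNReal.ofReal (C i * Real.exp (-(c i * (k + 1 : ℕ)))) / ENNReal.ofReal ε := by
          gcongr
      _ = ENNReal.ofReal (C i * Real.exp (-(c i * (k + 1 : ℕ))) / ε) := by
          rw [ENNReal.ofReal_div_of_pos hεpos]
  have hreal : P.real S ≤ C i * Real.exp (-(c i * (k + 1 : ℕ))) / ε :=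
    ENNReal.toReal_le_of_le_ofReal (by positivity) hPS
  -- arithmetic: C_i e^{-c_i n}/ε = C_i e^{-c_i n + s_iγn/2} ≤ C_i e^{-(cmin/2) n} ≤ Csum e^{-(cmin/2)√n}
  have hγi : γ ≤ c i / s i := Finset.inf'_le _ hit
  have hsγ : s i * γ ≤ c i := by
    have := mul_le_mul_of_nonneg_left hγi hsi.le
    rwa [mul_div_cancel₀ _ hsi.ne'] at this
  have hcmin_i : cmin ≤ c i := Finset.inf'_le _ hit
  have hnpos : (0 : ℝ) < n := by rw [hn]; positivity
  have hsq : Real.sqrt ((k + 1 : ℕ) : ℝ) ≤ (k + 1 : ℕ) := by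
    rw [Real.sqrt_le_left (by positivity)]
    have h1 : (1 : ℝ) ≤ (k + 1 : ℕ) := by exact_mod_cast Nat.succ_pos k
    nlinarith
  calc P.real S ≤ C i * Real.exp (-(c i * (k + 1 : ℕ))) / ε := hreal
    _ = C i * Real.exp (-(c i * n) + s i * γ * n / 2) := by
        rw [hε, div_eq_mul_inv, ← Real.exp_neg, neg_neg, mul_assoc, ← Real.exp_add, hn]
    _ ≤ C i * Real.exp (-(cmin / 2 * n)) := by
        gcongr
        nlinarith [mul_le_mul_of_nonneg_right hsγ hnpos.le, mul_le_mul_of_nonneg_right hcmin_i hnpos.le]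
    _ ≤ Csum * Real.exp (-(cmin / 2 * Real.sqrt ((k + 1 : ℕ) : ℝ))) := by
        apply mul_le_mul
        · exact Finset.single_le_sum (f := fun j : I => C (j : ℝ)) (fun j _ => (hC j j.2).le) hit
        · apply Real.exp_le_exp.mpr
          rw [hn] at hnpos ⊢
          nlinarith [Real.sqrt_nonneg ((k + 1 : ℕ) : ℝ), hcmin_pos]
        · positivity
        · exact hCsum_pos.le

/-- **O'Connor's amplitude bound (39) from the Anderson-model facts.** Fürstenberg positivity and
the vectorwise uniform LDT (Bucaj et al. Thm 2.3, Prop. 3.6) imply the moderate-deviation bound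
for the amplitude `t_n² = D_n(e₁)² + D_{n-1}(e₁)²` vendored from O'Connor's proof of his Thm 6 in
`DisorderedHarmonicChainHighFrequency.lean` — in fact with `ℙ(t_n² ≤ e^{γn}) ≤ C e^{-αn}`: by
Markov's inequality from the locally uniform decay `𝔼 ‖Q_n e₁‖^{-s} ≤ C e^{-cn}`
(`chain_negMoment_decay_local`, `t_n = ‖Q_n e₁‖`) with `γ = min_i c_i/s_i` over a finite subcover
of the band. So both routes to (H) in this cluster rest on the same two textbook facts.
[cite: OConnor1975, §3 eq. (39)] [cite: BucajEtAl2019, Thm 2.3 and Prop. 3.6] -/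
theorem OConnor1975_amplitudeBound_of_anderson (hP : BucajEtAl2019_lyapunovPos)
    (hV : BucajEtAl2019_vectorLDT) : OConnor1975_amplitudeBound :=
  OConnor1975_amplitudeBound_of_core fun _τ _a _b hyp _ρ _ hρ _ω hω =>
    chain_logMoment_lower hP hV hyp hρ hω le_rfl

end Literature.Barriers.AtomisticToContinuum

end
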